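import Summits.RiemannHypothesis.RiemannHypothesis.Theses.RuelleBand
import Literature.NumberTheory.LFunctions.WeilCriterionConverse
import Literature.NumberTheory.LFunctions.WeilExplicitFormulaProofs
import Summits.RiemannHypothesis.RiemannHypothesis.Theorems.RuelleBandCofiniteCriticalLineStubDefinitizeAux
import HarnessLib.Audit

/-!
# Line `SketchIdeator1` (even Weil sector): the decomposition `Q(g) = Q(g_even) + Q(g_odd)`

Route `RuelleBand`, crux
`Summit.RiemannHypothesis.RiemannHypothesis.Theses.RuelleBand.ExactFirstBand`
(item stmt-RiemannHypothesis-2061), line `SketchIdeator1`, stub `stub_evenOddDecomposition` (the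
bookkeeping lemma "`Q = Q_even ⊕ Q_odd`" asked for by the triage panel).

For a REAL-valued test function `g : ℝ → ℂ` (`IsWeilTest g`, `Im g = 0`) with even part
`e(t) = (g(t) + g(-t))/2` and odd part `o(t) = (g(t) - g(-t))/2`, Weil's quadratic functional
`Q(g) = W(g ⋆ g̃)` (`Literature.NumberTheory.LFunctions.weilQuadratic`) splits exactly:

  `Q(g) = Q(e) + Q(o)`.

Equivalently: the functional-equation involution `J : g ↦ g(-·)` is a `Q`-isometry, so the two
`J`-isotypic components (even / odd) are `Q`-orthogonal.  As a corollary, Weil positivity on the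
real sector is equivalent to Weil positivity on the even real sector AND on the odd real sector
(`stub_evenOddDecomposition_positivity_iff`).

## Proof

Write `ĝ(s) = ∫ g(t) e^{(s-1/2)t} dt` (`weilMellin`) and `ǧ = (g(-·))^`.  For every `h` the
zero-side coefficient `P_h(ρ) = ĥ(ρ) conj ĥ(1 - ρ̄)` (`WeilConverse.pairCoeff`)
equals `ĥ(ρ) (h̃)^(ρ)` with `h̃(t) = conj h(-t)` (`weilMellin_weilReflect_holds`), and for REAL `h`
the involution `h̃` is just `h(-·)`.  Hence, by linearity of the transform (`weilMellin_add`,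
`weilMellin_const_mul`), with `G = ĝ(ρ)`, `N = ǧ(ρ)`:

* `P_g(ρ) = G · N`;
* `e` is real and even, `ê = (G + N)/2`, so `P_e(ρ) = ((G + N)/2)²`;
* `o` is real and odd (`o(-·) = (g(-·) - g)/2`), `ô = (G - N)/2`, so
  `P_o(ρ) = (G - N)/2 · (N - G)/2`;

and `G N = ((G+N)/2)² - ((G-N)/2)²`, i.e. `P_g(ρ) = P_e(ρ) + P_o(ρ)` at every `ρ`
(`stub_evenOddDecomposition_pairCoeff`).  Summing over the non-trivial zeros with multiplicity
(absolute convergence for test functions, `WeilConverse.summable_pairCoeff`) gives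
`Q₀(g) = Q₀(e) + Q₀(o)` for the zero-side forms `Q₀ = WeilConverse.zeroForm`, and
`Q₀(h) = Q(h)` for every test function `h` because both are the limit of the symmetric partial
zero sums of `h ⋆ h̃` (`WeilConverse.hasWeilZeroSide_zeroForm` and the PROVED explicit formula
`explicit_formula_holds`; limits in `ℂ` are unique — the tree lemma
`RuelleBandCofiniteCriticalLine.stub_definitize_weilQuadratic_eq_zeroForm` of the sibling crux
`CofiniteCriticalLine`, reused here).

References: A. Weil, *Sur les "formules explicites" de la théorie des nombres premiers* (1952);
E. Bombieri, *Remarks on Weil's quadratic functional in the theory of prime numbers I*, Rend.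
Lincei (9) 11 (2000), 183–233, §3.
-/

-- the problem directory `RiemannHypothesis/RiemannHypothesis` fixes the namespace (gate convention)
set_option linter.dupNamespace false

noncomputable section

open Complex MeasureTheory Filter Set
open scoped Real Topology ComplexConjugate

namespace Summit.RiemannHypothesis.RiemannHypothesis.Theorems.RuelleBandExactFirstBand

open Literature.NumberTheory.LFunctions
-- `Q(h) = Q₀(h)` for test `h` (explicit formula + `hasWeilZeroSide_zeroForm`), proved in the tree for
-- the sibling crux `CofiniteCriticalLine`; reused, not restated
open Summit.RiemannHypothesis.RiemannHypothesis.Theorems.RuelleBandCofiniteCriticalLine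
  (stub_definitize_weilQuadratic_eq_zeroForm)

/-! ### Test-function bookkeeping -/

/-- `t ↦ g(-t)` is a test function if `g` is (composition with the homeomorphism `t ↦ -t`).
[folklore] -/
theorem stub_evenOddDecomposition_isWeilTest_neg {g : ℝ → ℂ} (hg : IsWeilTest g) :
    IsWeilTest fun t : ℝ => g (-t) :=
  ⟨hg.1.comp contDiff_neg, hg.2.comp_homeomorph (Homeomorph.neg ℝ)⟩

/-- Half-sums of test functions are test functions. [folklore] -/
theorem stub_evenOddDecomposition_isWeilTest_half_add {g h : ℝ → ℂ} (hg : IsWeilTest g)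
    (hh : IsWeilTest h) : IsWeilTest fun t : ℝ => (g t + h t) / 2 := by
  have e : (fun t : ℝ => (g t + h t) / 2) = fun t : ℝ => (1 / 2 : ℂ) * (g + h) t := by
    funext t
    simp only [Pi.add_apply]
    ring
  rw [e]
  exact (hg.add hh).const_mul _

/-- Half-differences of test functions are test functions. [folklore] -/
theorem stub_evenOddDecomposition_isWeilTest_half_sub {g h : ℝ → ℂ} (hg : IsWeilTest g)
    (hh : IsWeilTest h) : IsWeilTest fun t : ℝ => (g t - h t) / 2 := by
  have e : (fun t : ℝ => (g t - h t) / 2) =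
      fun t : ℝ => (1 / 2 : ℂ) * (g + fun u : ℝ => (-1 : ℂ) * h u) t := by
    funext t
    simp only [Pi.add_apply]
    ring
  rw [e]
  exact (hg.add (hh.const_mul _)).const_mul _

/-! ### Transforms -/

/-- Linearity: `((g + h)/2)^ = (ĝ + ĥ)/2` for test functions `g, h`. [folklore] -/
theorem stub_evenOddDecomposition_weilMellin_half_add {g h : ℝ → ℂ} (hg : IsWeilTest g)
    (hh : IsWeilTest h) (s : ℂ) :
    weilMellin (fun t : ℝ => (g t + h t) / 2) s = (weilMellin g s + weilMellin h s) / 2 := by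
  have e : (fun t : ℝ => (g t + h t) / 2) = fun t : ℝ => (1 / 2 : ℂ) * (g + h) t := by
    funext t
    simp only [Pi.add_apply]
    ring
  rw [e, weilMellin_const_mul, weilMellin_add hg.1.continuous hg.2 hh.1.continuous hh.2]
  ring

/-- Linearity: `((g - h)/2)^ = (ĝ - ĥ)/2` for test functions `g, h`. [folklore] -/
theorem stub_evenOddDecomposition_weilMellin_half_sub {g h : ℝ → ℂ} (hg : IsWeilTest g)
    (hh : IsWeilTest h) (s : ℂ) :
    weilMellin (fun t : ℝ => (g t - h t) / 2) s = (weilMellin g s - weilMellin h s) / 2 := by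
  have hh' : IsWeilTest fun u : ℝ => (-1 : ℂ) * h u := hh.const_mul _
  have e : (fun t : ℝ => (g t - h t) / 2) =
      fun t : ℝ => (1 / 2 : ℂ) * (g + fun u : ℝ => (-1 : ℂ) * h u) t := by
    funext t
    simp only [Pi.add_apply]
    ring
  rw [e, weilMellin_const_mul, weilMellin_add hg.1.continuous hg.2 hh'.1.continuous hh'.2,
    weilMellin_const_mul]
  ring

/-- For a REAL-valued `g` the Weil involution `g̃(t) = conj g(-t)` is `g(-·)`. [folklore] -/
theorem stub_evenOddDecomposition_weilReflect_of_real {g : ℝ → ℂ}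
    (hreal : ∀ t : ℝ, (g t).im = 0) : weilReflect g = fun t : ℝ => g (-t) :=
  funext fun t ↦ Complex.conj_eq_iff_im.2 (hreal (-t))

/-- `P_g(ρ) = ĝ(ρ) · (g̃)^(ρ)` for every `g` (`(g̃)^(ρ) = conj ĝ(1 - ρ̄)`,
`weilMellin_weilReflect_holds`). [folklore] -/
theorem stub_evenOddDecomposition_pairCoeff_eq (g : ℝ → ℂ) (ρ : ℂ) :
    WeilConverse.pairCoeff g ρ = weilMellin g ρ * weilMellin (weilReflect g) ρ := by
  rw [WeilConverse.pairCoeff, weilMellin_weilReflect_holds g ρ]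

/-! ### The termwise identity and its sum -/

/-- **The termwise identity.** For a real-valued test function `g` with even part `e` and
odd part `o`: `P_g(ρ) = P_e(ρ) + P_o(ρ)` at every `ρ : ℂ`.  With `G = ĝ(ρ)`, `N = (g(-·))^(ρ)`:
`P_g = G N`, `P_e = ((G+N)/2)²`, `P_o = (G-N)/2 · (N-G)/2`. [folklore] -/
theorem stub_evenOddDecomposition_pairCoeff {g : ℝ → ℂ} (hg : IsWeilTest g)
    (hreal : ∀ t : ℝ, (g t).im = 0) (ρ : ℂ) :
    WeilConverse.pairCoeff g ρ =
      WeilConverse.pairCoeff (fun t : ℝ => (g t + g (-t)) / 2) ρ +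
        WeilConverse.pairCoeff (fun t : ℝ => (g t - g (-t)) / 2) ρ := by
  have hn : IsWeilTest fun t : ℝ => g (-t) := stub_evenOddDecomposition_isWeilTest_neg hg
  have hre_e : ∀ t : ℝ, ((g t + g (-t)) / 2).im = 0 := fun t ↦ by
    simp [Complex.div_ofNat_im, hreal]
  have hre_o : ∀ t : ℝ, ((g t - g (-t)) / 2).im = 0 := fun t ↦ by
    simp [Complex.div_ofNat_im, hreal]
  have hRg : weilReflect g = fun t : ℝ => g (-t) :=
    stub_evenOddDecomposition_weilReflect_of_real hreal
  have hRe : weilReflect (fun t : ℝ => (g t + g (-t)) / 2) =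
      fun t : ℝ => (g t + g (-t)) / 2 := by
    rw [stub_evenOddDecomposition_weilReflect_of_real hre_e]
    funext t
    simp only [neg_neg]
    ring
  have hRo : weilReflect (fun t : ℝ => (g t - g (-t)) / 2) =
      fun t : ℝ => (g (-t) - g t) / 2 := by
    rw [stub_evenOddDecomposition_weilReflect_of_real hre_o]
    funext t
    simp only [neg_neg]
  rw [stub_evenOddDecomposition_pairCoeff_eq, stub_evenOddDecomposition_pairCoeff_eq,
    stub_evenOddDecomposition_pairCoeff_eq, hRg, hRe, hRo,
    stub_evenOddDecomposition_weilMellin_half_add hg hn,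
    stub_evenOddDecomposition_weilMellin_half_sub hg hn,
    stub_evenOddDecomposition_weilMellin_half_sub hn hg]
  ring

/-- **Summation.** If `P_g = P_e + P_o` termwise and `e, o` are test functions, then
`Q₀(g) = Q₀(e) + Q₀(o)` for the zero-side forms (both series on the right converge absolutely,
`WeilConverse.summable_pairCoeff`). [folklore] -/
theorem stub_evenOddDecomposition_zeroForm {g e o : ℝ → ℂ} (he : IsWeilTest e)
    (ho : IsWeilTest o)
    (h : ∀ ρ : ℂ, WeilConverse.pairCoeff g ρ =
      WeilConverse.pairCoeff e ρ + WeilConverse.pairCoeff o ρ) :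
    WeilConverse.zeroForm g = WeilConverse.zeroForm e + WeilConverse.zeroForm o := by
  -- adapted from `WeilConverse.zeroForm_translateMix` (Literature/…/WeilCriterionConverse.lean)
  have hs := (WeilConverse.summable_pairCoeff he).hasSum.add
    (WeilConverse.summable_pairCoeff ho).hasSum
  rw [WeilConverse.zeroForm]
  refine Eq.trans (tsum_congr fun ρ ↦ ?_) hs.tsum_eq
  rw [h]
  ring

/-- **Stub `stub_evenOddDecomposition` of line `SketchIdeator1` (registered signature) — the
`J`-isotypic decomposition `Q(g) = Q(g_even) + Q(g_odd)` for real test functions.**  For a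
real-valued test function `g` with even part `e(t) = (g(t) + g(-t))/2` and odd part
`o(t) = (g(t) - g(-t))/2` (both test functions): `Q(g) = Q(e) + Q(o)`.  Proof: `Q = Q₀` on
test functions (both are the limit of the symmetric partial zero sums of `h ⋆ h̃`: the PROVED
explicit formula `explicit_formula_holds` and `WeilConverse.hasWeilZeroSide_zeroForm`; tree lemma
`RuelleBandCofiniteCriticalLine.stub_definitize_weilQuadratic_eq_zeroForm`), and
`Q₀(g) = Q₀(e) + Q₀(o)` by summing the termwise identity `P_g(ρ) = P_e(ρ) + P_o(ρ)`
(`stub_evenOddDecomposition_pairCoeff`) over the non-trivial zeros. -/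
theorem stub_evenOddDecomposition :
    ∀ g : ℝ → ℂ, IsWeilTest g → (∀ t : ℝ, (g t).im = 0) →
      weilQuadratic g = weilQuadratic (fun t : ℝ => (g t + g (-t)) / 2) + weilQuadratic (fun t : ℝ => (g t - g (-t)) / 2) := by
  intro g hg hreal
  have hn : IsWeilTest fun t : ℝ => g (-t) := stub_evenOddDecomposition_isWeilTest_neg hg
  have he : IsWeilTest fun t : ℝ => (g t + g (-t)) / 2 :=
    stub_evenOddDecomposition_isWeilTest_half_add hg hn
  have ho : IsWeilTest fun t : ℝ => (g t - g (-t)) / 2 :=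
    stub_evenOddDecomposition_isWeilTest_half_sub hg hn
  rw [stub_definitize_weilQuadratic_eq_zeroForm hg, stub_definitize_weilQuadratic_eq_zeroForm he,
    stub_definitize_weilQuadratic_eq_zeroForm ho]
  exact stub_evenOddDecomposition_zeroForm he ho (stub_evenOddDecomposition_pairCoeff hg hreal)

/-- **Corollary: Weil positivity on real tests ⟺ positivity on the even AND on the odd real
sectors.**  `⟹`: even and odd real tests are real tests.  `⟸`: for a real test `g`,
`Q(g) = Q(e) + Q(o)` (`stub_evenOddDecomposition`) with `e` an even real test and `o` an odd real
test, so `Re Q(g) = Re Q(e) + Re Q(o) ≥ 0`. [folklore] -/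
theorem stub_evenOddDecomposition_positivity_iff :
    (∀ g : ℝ → ℂ, IsWeilTest g → (∀ t : ℝ, (g t).im = 0) → 0 ≤ (weilQuadratic g).re) ↔
      ((∀ g : ℝ → ℂ, IsWeilTest g → (∀ t : ℝ, g (-t) = g t) → (∀ t : ℝ, (g t).im = 0) →
          0 ≤ (weilQuadratic g).re) ∧
        ∀ g : ℝ → ℂ, IsWeilTest g → (∀ t : ℝ, g (-t) = -g t) → (∀ t : ℝ, (g t).im = 0) →
          0 ≤ (weilQuadratic g).re) := by
  refine ⟨fun H ↦ ⟨fun g hg _ hreal ↦ H g hg hreal, fun g hg _ hreal ↦ H g hg hreal⟩,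
    fun ⟨HE, HO⟩ g hg hreal ↦ ?_⟩
  have hn : IsWeilTest fun t : ℝ => g (-t) := stub_evenOddDecomposition_isWeilTest_neg hg
  have he := HE _ (stub_evenOddDecomposition_isWeilTest_half_add hg hn)
    (fun t ↦ by simp only [neg_neg]; ring)
    (fun t ↦ by simp [Complex.div_ofNat_im, hreal])
  have ho := HO _ (stub_evenOddDecomposition_isWeilTest_half_sub hg hn)
    (fun t ↦ by simp only [neg_neg]; ring)
    (fun t ↦ by simp [Complex.div_ofNat_im, hreal])
  rw [stub_evenOddDecomposition g hg hreal, Complex.add_re]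
  exact add_nonneg he ho

end Summit.RiemannHypothesis.RiemannHypothesis.Theorems.RuelleBandExactFirstBand

end
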